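import Mathlib

/-!
# `NewtonUnitEquationsNewtonTauWeakSignvecCount` — sign vectors of `M` affine functions along a line

Registered stub `stub_signvecCount` of line `binomial-normal-form` (crux `NewtonTauWeak`,
stmt-ValiantsHypothesis-5904), a piece of THEOREM G (hull vertices of block-residue level sets of subset sums
are polynomially many): the "signed order" of the numbers `⟨w, d_j⟩` as the direction `w = (±1, t)` moves
along a chart is the sign vector of finitely many affine functions of `t`, and the number of distinct such
sign vectors is linear in the number of functions.

Claim.  For `M` affine functions `t ↦ α m + t * β m` the set of realised sign vectors
`{(sign (α m + t β m))_m : t ∈ ℝ}` has at most `2 M + 1` elements.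

Proof.  Let `R` be the finite set of roots `-α m / β m` of the non-constant functions (`β m ≠ 0`),
`|R| ≤ M`.  A parameter `t` is either a root (at most `|R|` sign vectors) or not; off `R` the sign vector
of `t` only depends on the number `c t = #{ρ ∈ R : ρ < t} ∈ {0, …, |R|}` of roots to its left: indeed for
`β m ≠ 0` one has `α m + t β m = β m (t - ρ_m)` with `ρ_m = -α m / β m ∈ R`, `t ≠ ρ_m`, and
`ρ_m < t ↔ #{ρ ∈ R : ρ ≤ ρ_m} ≤ c t` (a root `ρ_m > t` lies in the right-hand set but not in the one counted
by `c t`).  Hence at most `|R| + (|R| + 1) ≤ 2 M + 1` sign vectors.  [folklore: arrangements of points on a line]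
-/

set_option linter.dupNamespace false

noncomputable section

open scoped BigOperators

namespace Summit.ValiantsHypothesis.ValiantsHypothesis.Theorems.NewtonUnitEquationsNewtonTauWeak

namespace SignvecCountAux

/-- Off the root set `R`, the sign of `α m + t * β m` is read off from the number of roots `< t`:
for `β m = 0` it is the constant `sign (α m)`, and for `β m ≠ 0` it is `± sign (β m)` according to whether
the root `-α m / β m` lies to the left of `t`, i.e. whether `#{ρ ∈ R : ρ ≤ -α m / β m} ≤ #{ρ ∈ R : ρ < t}`. -/
theorem sign_eq_of_not_root {M : ℕ} (α β : Fin M → ℝ) (R : Finset ℝ)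
    (hR : ∀ m, β m ≠ 0 → -α m / β m ∈ R) (t : ℝ) (ht : t ∉ R) (m : Fin M) :
    SignType.sign (α m + t * β m) =
      if β m = 0 then SignType.sign (α m)
      else if (R.filter (· ≤ -α m / β m)).card ≤ (R.filter (· < t)).card then SignType.sign (β m)
      else -SignType.sign (β m) := by
  by_cases hb : β m = 0
  · simp [hb]
  · rw [if_neg hb]
    have hρ : -α m / β m ∈ R := hR m hb
    have hne : t ≠ -α m / β m := fun h => ht (h ▸ hρ)
    have hfac : α m + t * β m = β m * (t - -α m / β m) := by
      field_simp
      ring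
    rw [hfac, sign_mul]
    rcases lt_or_gt_of_ne hne with hlt | hgt
    · -- `t` lies to the left of the root: negative factor, and the root is not counted by `c t`
      have h1 : SignType.sign (t - -α m / β m) = -1 := sign_neg (sub_neg.mpr hlt)
      have h2 : ¬ (R.filter (· ≤ -α m / β m)).card ≤ (R.filter (· < t)).card := by
        rw [not_le]
        apply Finset.card_lt_card
        refine ⟨?_, ?_⟩
        · intro r hr
          simp only [Finset.mem_filter] at hr ⊢
          exact ⟨hr.1, (hr.2.trans hlt).le⟩
        · intro hsub
          have hmem := hsub (Finset.mem_filter.mpr ⟨hρ, le_rfl⟩)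
          simp only [Finset.mem_filter] at hmem
          exact absurd hmem.2 (not_lt.mpr hlt.le)
      rw [if_neg h2, h1, mul_neg_one]
    · -- `t` lies to the right of the root: positive factor, and the root is counted by `c t`
      have h1 : SignType.sign (t - -α m / β m) = 1 := sign_pos (sub_pos.mpr hgt)
      have h2 : (R.filter (· ≤ -α m / β m)).card ≤ (R.filter (· < t)).card := by
        apply Finset.card_le_card
        intro r hr
        simp only [Finset.mem_filter] at hr ⊢
        exact ⟨hr.1, hr.2.trans_lt hgt⟩
      rw [if_pos h2, h1, mul_one]

end SignvecCountAux

/-- **Sign vectors along a line.**  For `M` affine functions `t ↦ α m + t * β m` of a real parameter, the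
sign vectors `(sign (α m + t * β m))_{m < M}` take at most `2 M + 1` distinct values as `t` ranges over `ℝ`
(at most `M` roots, each realising one vector, and at most `M + 1` open gaps between consecutive roots, on
each of which the sign vector is constant). -/
theorem stub_signvecCount (M : ℕ) (α β : Fin M → ℝ) :
    {v : Fin M → SignType | ∃ t : ℝ, v = fun m => SignType.sign (α m + t * β m)}.ncard ≤ 2 * M + 1 := by
  -- the finite set of roots of the non-constant functions
  obtain ⟨R, hR, hRcard⟩ : ∃ R : Finset ℝ, (∀ m, β m ≠ 0 → -α m / β m ∈ R) ∧ R.card ≤ M := by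
    refine ⟨(Finset.univ.filter (fun m => β m ≠ 0)).image (fun m => -α m / β m), fun m hm => ?_, ?_⟩
    · exact Finset.mem_image.mpr ⟨m, Finset.mem_filter.mpr ⟨Finset.mem_univ _, hm⟩, rfl⟩
    · calc ((Finset.univ.filter (fun m => β m ≠ 0)).image (fun m => -α m / β m)).card
          ≤ (Finset.univ.filter (fun m => β m ≠ 0)).card := Finset.card_image_le
        _ ≤ (Finset.univ : Finset (Fin M)).card := Finset.card_filter_le _ _
        _ = M := by simp
  -- off `R` the sign vector factors through the number of roots to the left of `t`
  obtain ⟨G, hG⟩ : ∃ G : ℕ → Fin M → SignType,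
      ∀ t, t ∉ R → (fun m => SignType.sign (α m + t * β m)) = G (R.filter (· < t)).card :=
    ⟨fun k m => if β m = 0 then SignType.sign (α m)
        else if (R.filter (· ≤ -α m / β m)).card ≤ k then SignType.sign (β m)
        else -SignType.sign (β m),
      fun t ht => funext fun m => SignvecCountAux.sign_eq_of_not_root α β R hR t ht m⟩
  have hsub : {v : Fin M → SignType | ∃ t : ℝ, v = fun m => SignType.sign (α m + t * β m)} ⊆
      (fun (t : ℝ) (m : Fin M) => SignType.sign (α m + t * β m)) '' (↑R : Set ℝ) ∪
        G '' (↑(Finset.range (R.card + 1)) : Set ℕ) := by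
    rintro v ⟨t, rfl⟩
    by_cases ht : t ∈ R
    · exact Or.inl ⟨t, ht, rfl⟩
    · refine Or.inr ⟨(R.filter (· < t)).card, ?_, (hG t ht).symm⟩
      exact Finset.mem_coe.mpr (Finset.mem_range.mpr (Nat.lt_succ_of_le (Finset.card_filter_le _ _)))
  calc {v : Fin M → SignType | ∃ t : ℝ, v = fun m => SignType.sign (α m + t * β m)}.ncard
      ≤ ((fun (t : ℝ) (m : Fin M) => SignType.sign (α m + t * β m)) '' (↑R : Set ℝ) ∪
          G '' (↑(Finset.range (R.card + 1)) : Set ℕ)).ncard :=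
        Set.ncard_le_ncard hsub (Set.toFinite _)
    _ ≤ ((fun (t : ℝ) (m : Fin M) => SignType.sign (α m + t * β m)) '' (↑R : Set ℝ)).ncard +
          (G '' (↑(Finset.range (R.card + 1)) : Set ℕ)).ncard :=
        Set.ncard_union_le _ _
    _ ≤ (↑R : Set ℝ).ncard + (↑(Finset.range (R.card + 1)) : Set ℕ).ncard :=
        add_le_add (Set.ncard_image_le R.finite_toSet) (Set.ncard_image_le (Finset.finite_toSet _))
    _ = R.card + (R.card + 1) := by
        rw [Set.ncard_coe_finset, Set.ncard_coe_finset, Finset.card_range]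
    _ ≤ 2 * M + 1 := by omega

end Summit.ValiantsHypothesis.ValiantsHypothesis.Theorems.NewtonUnitEquationsNewtonTauWeak
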